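import Mathlib.Analysis.Complex.UpperHalfPlane.Manifold
import Mathlib.Analysis.SpecialFunctions.Sqrt
import Literature.NumberTheory.Automorphic.NewformAdelisationArchCovariance
import Literature.NumberTheory.Automorphic.GL2ZFiniteOfEigenfunction
import HarnessLib

/-!
# The adelic lift of a holomorphic modular form is smooth in the archimedean variable
# (Gelbart 1975, Prop. 3.1 (iv); Borel–Jacquet 1979, 4.2 (b))

Topic `NumberTheory/Automorphic`; theorems only (no definition, no named fact). The purely ANALYTIC
brick of the dictionary `f ↦ φ_f` (Gelbart 1975, §3.A, (3.4), Prop. 3.1; Gelbart 1997, (2.5.4);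
Bump 1997, §3.6 with §2.1): for a holomorphic `f : ℍ → ℂ` of weight `k` and level `Γ₁(N)`, the
adelic lift `φ_f = adelicLiftFunA N k f : GL₂(𝔸_ℚ) → ℂ` is `C^∞` in the archimedean variable of the
Borel–Jacquet automorphy datum `AutomorphyDatum.gl 2 ℚ hcpt` (`IsArchSmooth`), the standing
hypothesis `hφ` of `NewformAdelisationCasimir` (`lowerFun_adelicLiftFunA_eq_zero`,
`casimirFun_adelicLiftFunA`, `sum_lieDeriv_single_adelicLiftFunA`) and of
`Rat.isZFinite_of_casimir_of_zed`, which is thereby discharged for cusp forms: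

* `contDiffOn_archLiftFormula`, `archLift_eq_archLiftFormula` — on `GL₂(ℝ)⁺ = {det > 0}` the
  archimedean lift `archLift k f g = f(g·i) (det g)^{k-1} j(g, i)^{-k} (√det g)^{2-k}` is an explicit
  real-smooth function of the matrix entries: `g ↦ g·i = (a i + b)/(c i + d)` is smooth with values
  in the upper half plane, `f ∘ ofComplex` is real-smooth there (holomorphic ⇒ analytic ⇒ `C^∞`,
  Mathlib `UpperHalfPlane.mdifferentiable_iff`, `DifferentiableOn.analyticOnNhd`), and `det`,
  `j(g, i) = c i + d ≠ 0`, `√det`, integer powers are smooth;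
* `det_expGL_pos` — `det (exp X) = (det exp(X/2))² > 0`; `contDiff_archLift_mul_expGL` — the
  exponential slices `X ↦ archLift k f (h₀ exp X)` through `h₀ ∈ GL₂(ℝ)⁺` are `C^∞` on `𝔤𝔩₂(ℝ)`;
* `isArchSmooth_iotaA_adelicLiftFunA` — **`φ_f` is smooth along `ι_𝔸 : GL₂(ℝ) → GL₂(𝔸_ℚ)`** at
  every adelic point (exact slices `φ_f(a ι_𝔸(x)) = archLift k f (h₀ x)`,
  `exists_archSlice_adelicLiftFun`);
* `isArchSmooth_ofArch_of_iotaA` — **smoothness along `ι_𝔸` is smoothness for the datum** (the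
  converse of `IsArchSmooth.iotaA`: `X ↦ X ⊗ 1`, `𝔤𝔩₂(ℝ) → 𝔤𝔩₂(ℚ_∞)`, is a linear isomorphism since
  `ℝ ≃ ℚ_∞ = mixedSpace ℚ`, `Rat.bijective_algebraMap_mixedSpace`);
* `isArchSmooth_ofArch_adelicLiftFunA`, `isArchSmooth_ofArch_adelicLiftFunA_cuspForm` — **`φ_f` is
  smooth in the archimedean variable of the datum** (Borel–Jacquet 1979, 4.2 (b) for `φ_f`;
  Gelbart 1975, Prop. 3.1 (iv): "`φ_f`, viewed as a function of `G_∞` alone, is `C^∞`"). With it,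
  `X φ_f = 0` along `ι_𝔸` (Gelbart 1975, Prop. 3.1 (v): the Cauchy–Riemann equations of `f` read in
  the group) and the Casimir eigenvalue of `φ_f` hold unconditionally for cusp forms
  (`lowerFun_adelicLiftFunA_eq_zero`, `sum_lieDeriv_single_adelicLiftFunA` of
  `NewformAdelisationCasimir`, which this file deliberately does not import).

## References

* S. Gelbart, *Automorphic forms on adele groups*, Ann. of Math. Stud. 83 (1975), §3.A, (3.4),
  Prop. 3.1 (iv)–(v). [Gelbart1975]
* S. Gelbart, *Three lectures on the modularity of `ρ̄_{E,3}` …* (1997), (2.5.4). [Gelbart1997]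
* D. Bump, *Automorphic Forms and Representations* (1997), §2.1, §3.6. [Bump1997]
* A. Borel, H. Jacquet, *Automorphic forms and automorphic representations*, Corvallis (1979),
  §1.1, 4.1–4.2. [BorelJacquetCorvallis1979]
-/

noncomputable section

open scoped MatrixGroups Matrix ContDiff Topology Manifold ModularForm Classical
open UpperHalfPlane NumberField NumberField.mixedEmbedding

namespace Literature.NumberTheory.Automorphic

-- Mathlib idiom (Mathlib/Algebra/Lie/OfAssociative.lean), as in `GL2WeightVectors`: Lie subalgebras of matrix algebras.
attribute [local instance 100] LieRing.ofAssociativeRing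

open GL2Real

/-! ### Real-smoothness of the ingredients of the archimedean lift -/

section Ingredients

/-- Integer powers are real-smooth on `ℂ ∖ {0}` (they are complex-analytic there). [folklore] -/
theorem contDiffAt_real_zpow (m : ℤ) {z : ℂ} (hz : z ≠ 0) :
    ContDiffAt ℝ ∞ (fun w : ℂ => w ^ m) z := by
  have h : AnalyticOnNhd ℂ (fun w : ℂ => w ^ m) {0}ᶜ :=
    (differentiableOn_zpow m _ (Or.inl (by simp))).analyticOnNhd isOpen_compl_singleton
  exact (h z hz).contDiffAt.restrict_scalars ℝ

/-- A holomorphic function on `ℍ`, extended to `ℂ` through `ofComplex`, is real-smooth on the open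
upper half plane (holomorphic ⇒ analytic ⇒ `C^∞`; Mathlib `UpperHalfPlane.mdifferentiable_iff`,
`DifferentiableOn.analyticOnNhd`). [folklore] -/
theorem contDiffOn_comp_ofComplex {f : ℍ → ℂ} (hf : MDifferentiable 𝓘(ℂ) 𝓘(ℂ) f) :
    ContDiffOn ℝ ∞ (f ∘ ofComplex) {z : ℂ | 0 < z.im} :=
  ((UpperHalfPlane.mdifferentiable_iff.mp hf).analyticOnNhd
    isOpen_upperHalfPlaneSet).contDiffOn_of_completeSpace.restrict_scalars ℝ

/-- For a real `2 × 2` matrix `M` of positive determinant, `j(M, i) = M₁₀ i + M₁₁ ≠ 0` and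
`M · i = (M₀₀ i + M₀₁) / (M₁₀ i + M₁₁)` lies in the upper half plane
(`Im (M · i) = det M / |j(M, i)|²`). [folklore] -/
theorem archDenom_ne_zero_and_im_pos {M : Matrix (Fin 2) (Fin 2) ℝ} (hM : 0 < M.det) :
    ((M 1 0 : ℂ) * Complex.I + M 1 1 ≠ 0) ∧
      0 < (((M 0 0 : ℂ) * Complex.I + M 0 1) / ((M 1 0 : ℂ) * Complex.I + M 1 1)).im := by
  have hdet : M.det = M 0 0 * M 1 1 - M 0 1 * M 1 0 := Matrix.det_fin_two M
  have h1 : (M 1 0 : ℂ) * Complex.I + M 1 1 ≠ 0 := by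
    intro h
    have hre := congrArg Complex.re h
    have him := congrArg Complex.im h
    simp only [Complex.add_re, Complex.mul_re, Complex.ofReal_re, Complex.I_re, mul_zero,
      Complex.ofReal_im, Complex.I_im, sub_zero, zero_add, Complex.zero_re,
      Complex.add_im, Complex.mul_im, mul_one, add_zero, Complex.zero_im] at hre him
    rw [hdet, hre, him, mul_zero, mul_zero, sub_zero] at hM
    exact lt_irrefl 0 hM
  refine ⟨h1, ?_⟩
  have hns : 0 < Complex.normSq ((M 1 0 : ℂ) * Complex.I + M 1 1) := Complex.normSq_pos.2 h1
  rw [Complex.div_im]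
  simp only [Complex.add_re, Complex.mul_re, Complex.ofReal_re, Complex.I_re, mul_zero,
    Complex.ofReal_im, Complex.I_im, sub_zero, zero_add, Complex.add_im, Complex.mul_im,
    mul_one, add_zero]
  rw [← sub_div]
  refine div_pos ?_ hns
  rw [hdet] at hM
  linarith

set_option backward.isDefEq.respectTransparency false in
open scoped Matrix.Norms.Operator in
/-- **The formula of the archimedean lift is real-smooth on `GL₂(ℝ)⁺`**: for `f` holomorphic on
`ℍ`, the function `M ↦ f(M·i) (det M)^{k-1} j(M, i)^{-k} (√det M)^{2-k}` of a real `2 × 2` matrix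
(`M·i = (M₀₀ i + M₀₁)/(M₁₀ i + M₁₁)`, `j(M, i) = M₁₀ i + M₁₁`; this is `archLift k f` on `{det > 0}`,
`archLift_eq_archLiftFormula`) is `C^∞` on the open set `{det M > 0}` — the entries are linear,
`M ↦ M·i` is smooth with values in the upper half plane, where `f ∘ ofComplex` is real-smooth
(`contDiffOn_comp_ofComplex`), and `det`, `j ≠ 0`, `√det`, `z ↦ z^m` are smooth. Gelbart 1975,
Prop. 3.1 (iv) (`φ_f` is `C^∞` in `g_∞`). [cite: Gelbart1975, Prop. 3.1] -/
theorem contDiffOn_archLiftFormula (k : ℤ) {f : ℍ → ℂ} (hf : MDifferentiable 𝓘(ℂ) 𝓘(ℂ) f) :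
    ContDiffOn ℝ ∞ (fun M : Matrix (Fin 2) (Fin 2) ℝ =>
      (f ∘ ofComplex) (((M 0 0 : ℂ) * Complex.I + M 0 1) / ((M 1 0 : ℂ) * Complex.I + M 1 1)) *
        ((M.det : ℝ) : ℂ) ^ (k - 1) * ((M 1 0 : ℂ) * Complex.I + M 1 1) ^ (-k) *
        ((Real.sqrt M.det : ℝ) : ℂ) ^ (2 - k)) {M | 0 < M.det} := by
  have hent : ∀ i j : Fin 2, ContDiff ℝ ∞ fun M : Matrix (Fin 2) (Fin 2) ℝ => M i j := fun i j =>
    (LinearMap.toContinuousLinearMap (Matrix.entryLinearMap ℝ ℝ i j)).contDiff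
  have hentC : ∀ i j : Fin 2, ContDiff ℝ ∞ fun M : Matrix (Fin 2) (Fin 2) ℝ => ((M i j : ℝ) : ℂ) :=
    fun i j => Complex.ofRealCLM.contDiff.comp (hent i j)
  have hdet : ContDiff ℝ ∞ fun M : Matrix (Fin 2) (Fin 2) ℝ => M.det := by
    have e : (fun M : Matrix (Fin 2) (Fin 2) ℝ => M.det) = fun M => M 0 0 * M 1 1 - M 0 1 * M 1 0 :=
      funext fun M => Matrix.det_fin_two M
    rw [e]
    exact ((hent 0 0).mul (hent 1 1)).sub ((hent 0 1).mul (hent 1 0))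
  have hdetC : ContDiff ℝ ∞ fun M : Matrix (Fin 2) (Fin 2) ℝ => ((M.det : ℝ) : ℂ) :=
    Complex.ofRealCLM.contDiff.comp hdet
  have hnum : ContDiff ℝ ∞ fun M : Matrix (Fin 2) (Fin 2) ℝ => (M 0 0 : ℂ) * Complex.I + M 0 1 :=
    ((hentC 0 0).mul contDiff_const).add (hentC 0 1)
  have hden : ContDiff ℝ ∞ fun M : Matrix (Fin 2) (Fin 2) ℝ => (M 1 0 : ℂ) * Complex.I + M 1 1 :=
    ((hentC 1 0).mul contDiff_const).add (hentC 1 1)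
  have hinv : ContDiffOn ℝ ∞ (fun M : Matrix (Fin 2) (Fin 2) ℝ =>
      ((M 1 0 : ℂ) * Complex.I + M 1 1) ^ (-1 : ℤ)) {M | 0 < M.det} := by
    intro M hM
    have hg : ContDiffAt ℝ ∞ (fun w : ℂ => w ^ (-1 : ℤ)) ((M 1 0 : ℂ) * Complex.I + M 1 1) :=
      contDiffAt_real_zpow (-1) (archDenom_ne_zero_and_im_pos hM).1
    exact hg.comp_contDiffWithinAt M hden.contDiffAt.contDiffWithinAt
  have hmoeb : ContDiffOn ℝ ∞ (fun M : Matrix (Fin 2) (Fin 2) ℝ =>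
      ((M 0 0 : ℂ) * Complex.I + M 0 1) / ((M 1 0 : ℂ) * Complex.I + M 1 1)) {M | 0 < M.det} := by
    refine (hnum.contDiffOn.mul hinv).congr fun M _ => ?_
    rw [zpow_neg_one, div_eq_mul_inv]
  have hF : ContDiffOn ℝ ∞ (fun M : Matrix (Fin 2) (Fin 2) ℝ =>
      (f ∘ ofComplex) (((M 0 0 : ℂ) * Complex.I + M 0 1) / ((M 1 0 : ℂ) * Complex.I + M 1 1)))
      {M | 0 < M.det} :=
    (contDiffOn_comp_ofComplex hf).comp hmoeb fun M hM => (archDenom_ne_zero_and_im_pos hM).2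
  have hz1 : ContDiffOn ℝ ∞ (fun M : Matrix (Fin 2) (Fin 2) ℝ => ((M.det : ℝ) : ℂ) ^ (k - 1))
      {M | 0 < M.det} := by
    intro M hM
    have hM' : 0 < M.det := hM
    have hg : ContDiffAt ℝ ∞ (fun w : ℂ => w ^ (k - 1)) ((M.det : ℝ) : ℂ) :=
      contDiffAt_real_zpow (k - 1) (Complex.ofReal_ne_zero.2 hM'.ne')
    exact hg.comp_contDiffWithinAt M hdetC.contDiffAt.contDiffWithinAt
  have hz2 : ContDiffOn ℝ ∞ (fun M : Matrix (Fin 2) (Fin 2) ℝ =>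
      ((M 1 0 : ℂ) * Complex.I + M 1 1) ^ (-k)) {M | 0 < M.det} := by
    intro M hM
    have hg : ContDiffAt ℝ ∞ (fun w : ℂ => w ^ (-k)) ((M 1 0 : ℂ) * Complex.I + M 1 1) :=
      contDiffAt_real_zpow (-k) (archDenom_ne_zero_and_im_pos hM).1
    exact hg.comp_contDiffWithinAt M hden.contDiffAt.contDiffWithinAt
  have hsqrt : ContDiffOn ℝ ∞ (fun M : Matrix (Fin 2) (Fin 2) ℝ => ((Real.sqrt M.det : ℝ) : ℂ))
      {M | 0 < M.det} :=
    Complex.ofRealCLM.contDiff.comp_contDiffOn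
      (hdet.contDiffOn.sqrt fun M hM => (show 0 < M.det from hM).ne')
  have hz3 : ContDiffOn ℝ ∞ (fun M : Matrix (Fin 2) (Fin 2) ℝ =>
      ((Real.sqrt M.det : ℝ) : ℂ) ^ (2 - k)) {M | 0 < M.det} := by
    intro M hM
    have hM' : 0 < M.det := hM
    have hg : ContDiffAt ℝ ∞ (fun w : ℂ => w ^ (2 - k)) ((Real.sqrt M.det : ℝ) : ℂ) :=
      contDiffAt_real_zpow (2 - k) (Complex.ofReal_ne_zero.2 (Real.sqrt_pos.2 hM').ne')
    exact hg.comp_contDiffWithinAt M (hsqrt M hM)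
  exact ((hF.mul hz1).mul hz2).mul hz3

/-- **The archimedean lift on `GL₂(ℝ)⁺` is the smooth formula** of `contDiffOn_archLiftFormula`
evaluated at the matrix of `g`: `archLift k f g = f(g·i) (det g)^{k-1} j(g,i)^{-k} (√det g)^{2-k}`
with `g·i = (g₀₀ i + g₀₁)/(g₁₀ i + g₁₁)` read through `ofComplex` (`archLift_apply_of_det_pos`,
Mathlib `UpperHalfPlane.coe_smul_of_det_pos`). Gelbart 1975, (3.4). [cite: Gelbart1975, (3.4)] -/
theorem archLift_eq_archLiftFormula (k : ℤ) (f : ℍ → ℂ) {g : GL (Fin 2) ℝ} (hg : 0 < g.det.val) :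
    archLift k f g =
      (f ∘ ofComplex)
          (((((g : Matrix (Fin 2) (Fin 2) ℝ) 0 0 : ℝ) : ℂ) * Complex.I + (g : Matrix (Fin 2) (Fin 2) ℝ) 0 1) /
            ((((g : Matrix (Fin 2) (Fin 2) ℝ) 1 0 : ℝ) : ℂ) * Complex.I + (g : Matrix (Fin 2) (Fin 2) ℝ) 1 1)) *
        (((g : Matrix (Fin 2) (Fin 2) ℝ).det : ℝ) : ℂ) ^ (k - 1) *
        ((((g : Matrix (Fin 2) (Fin 2) ℝ) 1 0 : ℝ) : ℂ) * Complex.I + (g : Matrix (Fin 2) (Fin 2) ℝ) 1 1) ^ (-k) *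
        ((Real.sqrt (g : Matrix (Fin 2) (Fin 2) ℝ).det : ℝ) : ℂ) ^ (2 - k) := by
  have hcoe : ((g • UpperHalfPlane.I : ℍ) : ℂ) = num g UpperHalfPlane.I / denom g UpperHalfPlane.I :=
    coe_smul_of_det_pos hg _
  have hfI : f (g • UpperHalfPlane.I) =
      (f ∘ ofComplex) (num g UpperHalfPlane.I / denom g UpperHalfPlane.I) := by
    rw [Function.comp_apply, ← hcoe, ofComplex_apply]
  rw [archLift_apply_of_det_pos k f hg, hfI, Matrix.GeneralLinearGroup.val_det_apply]
  rfl

/-- **`det (exp X) > 0`** for a real square matrix: `exp X = (exp (X/2))²` and `exp (X/2)` is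
invertible. [folklore] -/
theorem det_expGL_pos {n : Type*} [Fintype n] [DecidableEq n] (X : Matrix n n ℝ) :
    0 < (expGL X).det.val := by
  have h : expGL X = expGL ((1 / 2 : ℝ) • X) * expGL ((1 / 2 : ℝ) • X) := by
    rw [← expGL_add_of_commute _ _ (Commute.refl _), ← add_smul]
    norm_num
  rw [h, map_mul, Units.val_mul]
  exact mul_self_pos.2 (expGL ((1 / 2 : ℝ) • X)).det.ne_zero

set_option backward.isDefEq.respectTransparency false in
open scoped Matrix.Norms.Operator in
/-- **The exponential slices of the archimedean lift through `GL₂(ℝ)⁺` are smooth**: for `f`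
holomorphic on `ℍ` and `det h₀ > 0`, `X ↦ archLift k f (h₀ exp X)` is `C^∞` on `𝔤𝔩₂(ℝ)` (the matrix
exponential is analytic, `det (h₀ exp X) > 0`, and `archLift k f` is the smooth formula there).
Gelbart 1975, Prop. 3.1 (iv); Borel–Jacquet 1979, §1.1. [cite: Gelbart1975, Prop. 3.1] -/
theorem contDiff_archLift_mul_expGL (k : ℤ) {f : ℍ → ℂ} (hf : MDifferentiable 𝓘(ℂ) 𝓘(ℂ) f)
    {h₀ : GL (Fin 2) ℝ} (hh₀ : 0 < h₀.det.val) :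
    ContDiff ℝ ∞ fun M : Matrix (Fin 2) (Fin 2) ℝ => archLift k f (h₀ * expGL M) := by
  have hexp : ContDiff ℝ ∞ (NormedSpace.exp : Matrix (Fin 2) (Fin 2) ℝ → Matrix (Fin 2) (Fin 2) ℝ) :=
    contDiff_iff_contDiffAt.2 fun M => (NormedSpace.exp_analytic (𝕂 := ℝ) M).contDiffAt
  have hP : ContDiff ℝ ∞ fun M : Matrix (Fin 2) (Fin 2) ℝ =>
      (h₀ : Matrix (Fin 2) (Fin 2) ℝ) * NormedSpace.exp M := contDiff_const.mul hexp
  have hdet : ∀ M : Matrix (Fin 2) (Fin 2) ℝ, 0 < (h₀ * expGL M).det.val := fun M => by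
    rw [map_mul, Units.val_mul]
    exact mul_pos hh₀ (det_expGL_pos M)
  have hPU : ∀ M : Matrix (Fin 2) (Fin 2) ℝ,
      (h₀ : Matrix (Fin 2) (Fin 2) ℝ) * NormedSpace.exp M ∈ {M : Matrix (Fin 2) (Fin 2) ℝ | 0 < M.det} :=
    fun M => by
    have h := hdet M
    rwa [Matrix.GeneralLinearGroup.val_det_apply, Units.val_mul, coe_expGL] at h
  have h := (contDiffOn_archLiftFormula k hf).comp_contDiff hP hPU
  convert h using 1
  funext M
  rw [Function.comp_apply, archLift_eq_archLiftFormula k f (hdet M), Units.val_mul, coe_expGL]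

end Ingredients

/-! ### Smoothness of `φ_f` along `ι_𝔸` and for the automorphy datum -/

section Lift

variable {N : ℕ} [NeZero N] {k : ℤ} {F : Type*} [FunLike F ℍ ℂ]
  [SlashInvariantFormClass F (CongruenceSubgroup.Gamma1 N) k]
  {hcpt : isCompact_glFiniteIntegralLevel 2 ℚ}

set_option backward.isDefEq.respectTransparency false in
open scoped Matrix.Norms.Operator in
/-- **`φ_f` is smooth along `ι_𝔸 : GL₂(ℝ) → GL₂(𝔸_ℚ)` at every adelic point** for `f` holomorphic and
slash-invariant of level `Γ₁(N)`: on the exact slice through `a`,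
`φ_f(a ι_𝔸(exp X)) = archLift k f (h₀ exp X)` with `det h₀ > 0` (`exists_archSlice_adelicLiftFun`,
`det (exp X) > 0`), a smooth function of `X ∈ 𝔤𝔩₂(ℝ)` (`contDiff_archLift_mul_expGL`).
Gelbart 1975, Prop. 3.1 (iv). [cite: Gelbart1975, Prop. 3.1] -/
theorem isArchSmooth_iotaA_adelicLiftFunA (f : F) (hf : MDifferentiable 𝓘(ℂ) 𝓘(ℂ) (f : ℍ → ℂ)) :
    IsArchSmooth Rat.iotaA (adelicLiftFunA N k f) := by
  intro a
  obtain ⟨h₀, hh₀, hslice⟩ :=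
    exists_archSlice_adelicLiftFun f (show GL (Fin 2) (AdeleRing (𝓞 ℚ) ℚ) from a)
  have e : (fun X : (RealMatrixGroup.gl ℝ (Fin 2)).lie.toSubmodule =>
      adelicLiftFunA N k f (a * Rat.iotaA
        ((RealMatrixGroup.gl ℝ (Fin 2)).expMem ⟨(X : Matrix (Fin 2) (Fin 2) ℝ), X.2⟩))) =
      (fun M : Matrix (Fin 2) (Fin 2) ℝ => archLift k f (h₀ * expGL M)) ∘
        (RealMatrixGroup.gl ℝ (Fin 2)).lie.toSubmodule.subtype := by
    funext X
    change adelicLiftFun N k f ((show GL (Fin 2) (AdeleRing (𝓞 ℚ) ℚ) from a) *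
        Rat.ofRealGL 2 (expGL (X : Matrix (Fin 2) (Fin 2) ℝ))) =
      archLift k f (h₀ * expGL (X : Matrix (Fin 2) (Fin 2) ℝ))
    exact hslice _ (det_expGL_pos _)
  rw [e]
  exact (contDiff_archLift_mul_expGL k hf hh₀).comp
    (RealMatrixGroup.gl ℝ (Fin 2)).lie.toSubmodule.subtypeL.contDiff

set_option backward.isDefEq.respectTransparency false in
open scoped Matrix.Norms.Operator in
/-- **Smoothness along `ι_𝔸` is smoothness for the `GL₂/ℚ` automorphy datum** (converse of
`IsArchSmooth.iotaA`): the slice of `φ` at `g` along the archimedean group `GL₂(ℚ_∞)` of the datum,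
`Y ↦ φ(g · ofArch(exp Y))`, is the slice along `ι_𝔸`, `X ↦ φ(g ι_𝔸(exp X))`, composed with the
inverse of the real-linear isomorphism `X ↦ X ⊗ 1 : 𝔤𝔩₂(ℝ) ≃ 𝔤𝔩₂(ℚ_∞)`
(`ℝ ≃ ℚ_∞ = mixedSpace ℚ`, `Rat.bijective_algebraMap_mixedSpace`; `Rat.mul_ofArch_expMem_lieOfReal`).
Borel–Jacquet 1979, §4.1. [cite: BorelJacquetCorvallis1979, §4.1] -/
theorem isArchSmooth_ofArch_of_iotaA {φ : (AdelicGroupData.gl 2 ℚ).Adelic → ℂ}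
    (hφ : IsArchSmooth Rat.iotaA φ) : IsArchSmooth (AutomorphyDatum.gl 2 ℚ hcpt).ofArch φ := by
  intro g
  -- `ℝ ≃ ℚ_∞` and the inverse `Y ↦ Y ⊗ 1⁻¹` of `X ↦ X ⊗ 1` on the Lie algebras (both `⊤`)
  let α : ℝ ≃ₐ[ℝ] mixedSpace ℚ :=
    AlgEquiv.ofBijective (Algebra.ofId ℝ (mixedSpace ℚ)) Rat.bijective_algebraMap_mixedSpace
  have hα : ∀ x : mixedSpace ℚ, algebraMap ℝ (mixedSpace ℚ) (α.symm x) = x := fun x =>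
    α.apply_symm_apply x
  let L' : (AutomorphyDatum.gl 2 ℚ hcpt).arch.lie.toSubmodule →ₗ[ℝ]
      (RealMatrixGroup.gl ℝ (Fin 2)).lie.toSubmodule :=
    LinearMap.codRestrict _
      ((α.symm.toLinearMap.mapMatrix : Matrix (Fin 2) (Fin 2) (mixedSpace ℚ) →ₗ[ℝ]
          Matrix (Fin 2) (Fin 2) ℝ) ∘ₗ (AutomorphyDatum.gl 2 ℚ hcpt).arch.lie.toSubmodule.subtype)
      fun _ => LieSubalgebra.mem_top _
  have hL' : ContDiff ℝ ∞ (L' : (AutomorphyDatum.gl 2 ℚ hcpt).arch.lie.toSubmodule →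
      (RealMatrixGroup.gl ℝ (Fin 2)).lie.toSubmodule) :=
    (⟨L', L'.continuous_of_finiteDimensional⟩ :
      (AutomorphyDatum.gl 2 ℚ hcpt).arch.lie.toSubmodule →L[ℝ]
        (RealMatrixGroup.gl ℝ (Fin 2)).lie.toSubmodule).contDiff
  have h := (hφ g).comp hL'
  -- the two slices agree
  have e : (fun Y : (AutomorphyDatum.gl 2 ℚ hcpt).arch.lie.toSubmodule =>
      φ (g * (AutomorphyDatum.gl 2 ℚ hcpt).ofArch ((AutomorphyDatum.gl 2 ℚ hcpt).arch.expMem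
        ⟨(Y : Matrix (Fin 2) (Fin 2) (mixedSpace ℚ)), Y.2⟩))) =
      (fun X : (RealMatrixGroup.gl ℝ (Fin 2)).lie.toSubmodule =>
        φ (g * Rat.iotaA ((RealMatrixGroup.gl ℝ (Fin 2)).expMem
          ⟨(X : Matrix (Fin 2) (Fin 2) ℝ), X.2⟩))) ∘ L' := by
    funext Y
    have h1 := Rat.mul_ofArch_expMem_lieOfReal (hcpt := hcpt) g
      ((L' Y : (RealMatrixGroup.gl ℝ (Fin 2)).lie.toSubmodule) : Matrix (Fin 2) (Fin 2) ℝ) 1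
    rw [one_smul, one_smul] at h1
    have hY : (⟨(Y : Matrix (Fin 2) (Fin 2) (mixedSpace ℚ)), Y.2⟩ : (AutomorphyDatum.gl 2 ℚ hcpt).arch.lie) =
        Rat.lieOfReal hcpt ((L' Y : (RealMatrixGroup.gl ℝ (Fin 2)).lie.toSubmodule) :
          Matrix (Fin 2) (Fin 2) ℝ) := by
      apply Subtype.ext
      change (Y : Matrix (Fin 2) (Fin 2) (mixedSpace ℚ)) =
        ((Y : Matrix (Fin 2) (Fin 2) (mixedSpace ℚ)).map α.symm).map (algebraMap ℝ (mixedSpace ℚ))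
      refine Matrix.ext fun i j => ?_
      rw [Matrix.map_apply, Matrix.map_apply, hα]
    simp only [Function.comp_apply]
    rw [hY, h1]
    rfl
  rw [e]
  exact h

/-- **The adelic lift of a holomorphic form is smooth in the archimedean variable of the `GL₂/ℚ`
automorphy datum** — condition (b) ("`f` is `C^∞` in `x_∞`") of Borel–Jacquet 1979, 4.2, for
`φ_f = adelicLiftFunA N k f`, `f` holomorphic and slash-invariant of level `Γ₁(N)`; Gelbart 1975,
Prop. 3.1 (iv). This is the hypothesis `hφ` of `lowerFun_adelicLiftFunA_eq_zero`,
`casimirFun_adelicLiftFunA`, `sum_lieDeriv_single_adelicLiftFunA` (`NewformAdelisationCasimir`).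
[cite: Gelbart1975, Prop. 3.1] [cite: BorelJacquetCorvallis1979, §4.2] -/
theorem isArchSmooth_ofArch_adelicLiftFunA (f : F) (hf : MDifferentiable 𝓘(ℂ) 𝓘(ℂ) (f : ℍ → ℂ)) :
    IsArchSmooth (AutomorphyDatum.gl 2 ℚ hcpt).ofArch (adelicLiftFunA N k f) :=
  isArchSmooth_ofArch_of_iotaA (isArchSmooth_iotaA_adelicLiftFunA f hf)

/-- **The adelic lift of a cusp form `f ∈ S_k(Γ₁(N))` is smooth in the archimedean variable** of the
`GL₂/ℚ` automorphy datum (cusp forms are holomorphic, Mathlib `CuspFormClass.holo`).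
[cite: Gelbart1975, Prop. 3.1] -/
theorem isArchSmooth_ofArch_adelicLiftFunA_cuspForm (f : CuspForm (CongruenceSubgroup.Gamma1 N) k) :
    IsArchSmooth (AutomorphyDatum.gl 2 ℚ hcpt).ofArch (adelicLiftFunA N k f) :=
  isArchSmooth_ofArch_adelicLiftFunA (N := N) (k := k) f (CuspFormClass.holo f)

end Lift

end Literature.NumberTheory.Automorphic
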